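import Mathlib
import HarnessLib
import Summits.Parity.GeneralizedHardyLittlewood.Theorems.DilatedChowla.Negative.DilatedChowlaWelch

/-!
# `DilatedChowla` (stmt-Parity-13319): the pretender obstruction

Negative lemma (cdisprove seat) for the crux `LiouvilleMAD.DilatedChowla` (route LiouvilleMAD,
rank-4 node): a "must-use" constraint on proofs.  At the smallest dilation pair `(n,n') = (1,2)`
and shift `c = 1` the pencil sum is `S 1 1 2 M = Σ_{m ∈ (M,2M]} λ(m+1) λ(2m+1)`.  Replace `λ` by a
PRETENDER: a completely multiplicative `f : ℕ → {±1}` with `f(p) = −1 = λ(p)` at EVERY prime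
`p ≤ 2M + 1` (so `f = λ` on `[1, 2M+1]`, in particular on every first factor `m + 1`).  Then the
bound of the crux can fail as badly as the prime number theorem allows:

* §1 `twist P` — `λ` with its sign flipped at the primes of a finite set `P` — is completely
  multiplicative, `±1`-valued, and equals `λ` below `min P` (`twist_mul`, `twist_eq_one_or`,
  `twist_eq_L_of_lt`, `twist_prime`).
* §2 The primes `p = 2m+1 ∈ (2M+1, 4M+1]` are PRIVATE to the term `m` (they divide no `m'+1 ≤ 2M+1`
  and no other `2m'+1 ≤ 4M+1 < 2p`), so flipping them steers those terms one by one: for every `M`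
  there is a flip set `P ⊆ (2M+1, 4M+1]` with
  `#{m ∈ (M,2M] : 2m+1 prime} ≤ |Σ_{m ∈ (M,2M]} twist P (m+1) · twist P (2m+1)|`
  (`pretender_sum`), packaged as `pretender_failure`.
* §3 `#{m ∈ (M,2M] : 2m+1 prime} = π(4M+1) − π(2M+1)` (`card_switchSet_eq_primeCounting_sub`), so the
  pretender sum is `≥ π(4M+1) − π(2M+1)`, which is `≥ M/log(2M+1)` for large `M` by the prime
  number theorem (companion file `DilatedChowlaPretenderPNT`: `primeCounting_window_ge`) — hence
  the crux's inequality at `(1,1,2)` extended to all pretenders is false (companion file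
  `DilatedChowlaPretenderFalse`: `not_dilatedChowlaForPretenders`).  Consequence: any proof of the
  crux must use `λ(p) = −1` at primes ABOVE the length `M` of the sum (here: in `(2M+1, 4M+1]`) —
  information that pretentious-distance, short-sum (Matomäki–Radziwiłł) and small-prime entropy
  methods do not carry, since their inputs are unchanged by such flips.  The same construction
  with the flips restricted to the prime values `2m+1 ∈ ((1−ε)(4M+1), 4M+1]` keeps `f = λ` at ALL
  primes `≤ (1−ε)(4M+1)` and still moves the sum by `π(4M+1) − π((1−ε)(4M+1)) ≍ εM/log M`: what a
  proof must use is the sign `λ = −1` at the prime VALUES of the second linear form itself.  (For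
  dilations `n' ≍ M` the private primes of `n'm + c ≍ M²` push the agreement range to
  `p ≤ M^{1+ε}`; not formalised — it needs smooth numbers in a sparse progression.)

No cited facts; elementary. [folklore]
-/

noncomputable section

namespace Summit.Parity.GeneralizedHardyLittlewood.Theorems.DilatedChowla.Negative

open Summit.Parity.GeneralizedHardyLittlewood.Theses.LiouvilleMAD
open Summit.Parity.GeneralizedHardyLittlewood.Theorems.DilatedTableChowla.Negative
  (L L_of_pos L_mul_self_of_pos L_natCast L_natCast_mul)
open Finset Filter
open scoped Classical

/-! ## §1 Twisting `λ` at a finite set of primes -/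

/-- Number of prime factors of `u` (with multiplicity) lying in `P`. -/
def omegaIn (P : Finset ℕ) (u : ℕ) : ℕ := (u.primeFactorsList).countP (· ∈ P)

/-- The pretender `twist P u = λ(u) · (−1)^{Ω_P(u)}`: the Liouville function with its sign flipped
at the primes of `P` (and `0` at `u = 0`). -/
def twist (P : Finset ℕ) (u : ℕ) : ℝ := (ArithmeticFunction.liouville u : ℝ) * (-1) ^ omegaIn P u

/-- `Ω_P` is completely additive. -/
theorem omegaIn_mul (P : Finset ℕ) {a b : ℕ} (ha : a ≠ 0) (hb : b ≠ 0) :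
    omegaIn P (a * b) = omegaIn P a + omegaIn P b := by
  unfold omegaIn
  rw [(Nat.perm_primeFactorsList_mul ha hb).countP_eq, List.countP_append]

/-- The pretender is completely multiplicative (on all of `ℕ`, as `twist P 0 = 0`). -/
theorem twist_mul (P : Finset ℕ) (a b : ℕ) : twist P (a * b) = twist P a * twist P b := by
  rcases eq_or_ne a 0 with rfl | ha
  · simp [twist]
  rcases eq_or_ne b 0 with rfl | hb
  · simp [twist]
  unfold twist
  rw [ArithmeticFunction.liouville_apply_mul, omegaIn_mul P ha hb, pow_add]
  push_cast; ring

/-- The pretender is `±1`-valued on positive integers. -/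
theorem twist_eq_one_or (P : Finset ℕ) {u : ℕ} (hu : 1 ≤ u) : twist P u = 1 ∨ twist P u = -1 := by
  unfold twist
  rw [ArithmeticFunction.liouville_apply (by omega)]
  push_cast
  rw [← pow_add]
  exact neg_one_pow_eq_or ℝ _

/-- `|twist P u| ≤ 1`. -/
theorem abs_twist_le_one (P : Finset ℕ) (u : ℕ) : |twist P u| ≤ 1 := by
  rcases Nat.eq_zero_or_pos u with rfl | hu
  · simp [twist]
  · rcases twist_eq_one_or P hu with h | h <;> rw [h] <;> norm_num

/-- If no prime factor of `u` lies in `P`, the twist does nothing: `twist P u = λ(u)`. -/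
theorem twist_eq_L_of_forall (P : Finset ℕ) {u : ℕ} (h : ∀ p ∈ u.primeFactorsList, p ∉ P) :
    twist P u = L u := by
  unfold twist omegaIn
  rw [List.countP_eq_zero.mpr (fun p hp => by simpa using h p hp), pow_zero, mul_one, L_natCast]

/-- If every prime of `P` exceeds `u`, then `twist P u = λ(u)`. -/
theorem twist_eq_L_of_lt (P : Finset ℕ) {u : ℕ} (h : ∀ p ∈ P, u < p) : twist P u = L u :=
  twist_eq_L_of_forall P fun p hp hpP =>
    absurd (Nat.le_of_mem_primeFactorsList hp) (not_le.mpr (h p hpP))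
/-- At a prime: `twist P p = +1` if `p ∈ P` (flipped), `−1 = λ(p)` otherwise. -/
theorem twist_prime (P : Finset ℕ) {p : ℕ} (hp : p.Prime) :
    twist P p = if p ∈ P then 1 else -1 := by
  unfold twist omegaIn
  rw [ArithmeticFunction.liouville_apply hp.ne_zero, ArithmeticFunction.cardFactors_apply_prime hp,
    Nat.primeFactorsList_prime hp]
  by_cases h : p ∈ P <;> simp [h]

/-- With the empty flip set the pretender IS `λ`. -/
theorem twist_empty (u : ℕ) : twist ∅ u = L u :=
  twist_eq_L_of_forall ∅ fun _ _ h => (notMem_empty _ h).elim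

/-- READ-BACK: with `f = λ` the pretender sum at `(c,n,n') = (1,1,2)` is the crux's pencil sum
`S 1 1 2 M`. -/
theorem sum_twist_empty_eq_S (M : ℕ) :
    ∑ m ∈ Ioc M (2 * M), twist ∅ (m + 1) * twist ∅ (2 * m + 1) = S 1 1 2 M := by
  unfold S
  refine sum_congr rfl fun m _ => ?_
  rw [twist_empty, twist_empty]
  congr 1
  · congr 1; push_cast; ring
  · congr 1; push_cast; ring

/-! ## §2 Private primes and the steering construction -/

/-- The switchable terms: `m ∈ (M,2M]` with `2m+1` prime. -/
def switchSet (M : ℕ) : Finset ℕ := (Ioc M (2 * M)).filter (fun m => (2 * m + 1).Prime)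

/-- The flip set for a target sign `s`: the private primes `2m+1` of those switchable `m` whose
first factor has `λ(m+1) = s`. -/
def flipSet (M : ℕ) (s : ℝ) : Finset ℕ :=
  ((switchSet M).filter (fun m => L ((m + 1 : ℕ) : ℤ) = s)).image (fun m => 2 * m + 1)

/-- Membership in `switchSet`: the window and the primality of `2m+1`. -/
theorem mem_switchSet {M m : ℕ} : m ∈ switchSet M ↔ (M < m ∧ m ≤ 2 * M) ∧ (2 * m + 1).Prime := by
  simp only [switchSet, mem_filter, mem_Ioc]

/-- Membership in `flipSet`: `p = 2m+1` for a switchable `m` with `λ(m+1) = s`. -/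
theorem mem_flipSet {M : ℕ} {s : ℝ} {p : ℕ} :
    p ∈ flipSet M s ↔ ∃ m, (m ∈ switchSet M ∧ L ((m + 1 : ℕ) : ℤ) = s) ∧ 2 * m + 1 = p := by
  simp only [flipSet, mem_image, mem_filter]

/-- Every flipped prime is a prime exceeding `2M + 1`. -/
theorem prime_and_lt_of_mem_flipSet {M : ℕ} {s : ℝ} {p : ℕ} (hp : p ∈ flipSet M s) :
    p.Prime ∧ 2 * M + 1 < p := by
  obtain ⟨m, ⟨hm, _⟩, rfl⟩ := mem_flipSet.mp hp
  rw [mem_switchSet] at hm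
  exact ⟨hm.2, by omega⟩

/-- First factors are untouched: `twist (flipSet M s) (m+1) = λ(m+1)` for `m ≤ 2M`. -/
theorem twist_flipSet_first {M : ℕ} (s : ℝ) {m : ℕ} (hm : m ≤ 2 * M) :
    twist (flipSet M s) (m + 1) = L ((m + 1 : ℕ) : ℤ) :=
  twist_eq_L_of_lt _ fun p hp => by have := (prime_and_lt_of_mem_flipSet hp).2; omega

/-- Non-switchable second factors are untouched: if `2m+1 ≤ 4M+1` is NOT prime, all its prime
factors are `≤ 2M < min (flipSet)`, so `twist (flipSet M s) (2m+1) = λ(2m+1)`. -/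
theorem twist_flipSet_second_of_not_prime {M : ℕ} (s : ℝ) {m : ℕ} (hm : m ≤ 2 * M)
    (hnp : ¬ (2 * m + 1).Prime) :
    twist (flipSet M s) (2 * m + 1) = L ((2 * m + 1 : ℕ) : ℤ) := by
  refine twist_eq_L_of_forall _ fun q hq hqP => ?_
  have hqprime : q.Prime := Nat.prime_of_mem_primeFactorsList hq
  have hqdvd : q ∣ 2 * m + 1 := Nat.dvd_of_mem_primeFactorsList hq
  have hqlt : 2 * M + 1 < q := (prime_and_lt_of_mem_flipSet hqP).2
  obtain ⟨k, hk⟩ := hqdvd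
  -- `q ≠ 2m+1` (not prime), so the cofactor is `≥ 2` and `2q ≤ 2m+1 ≤ 4M+1`, i.e. `q ≤ 2M`.
  have hk2 : 2 ≤ k := by
    by_contra hk1
    push Not at hk1
    interval_cases k
    · omega
    · rw [mul_one] at hk
      rw [hk] at hnp
      exact hnp hqprime
  have h2q : 2 * q ≤ 2 * m + 1 := by rw [hk]; nlinarith
  omega

/-- Switchable second factors are steered: for `m ∈ switchSet M` (so `p = 2m+1` is prime and
private), `twist (flipSet M s) (2m+1) = +1` iff `λ(m+1) = s`, else `−1`. -/
theorem twist_flipSet_second_of_mem {M : ℕ} (s : ℝ) {m : ℕ} (hm : m ∈ switchSet M) :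
    twist (flipSet M s) (2 * m + 1) = if L ((m + 1 : ℕ) : ℤ) = s then 1 else -1 := by
  rw [twist_prime _ (mem_switchSet.mp hm).2]
  have hiff : 2 * m + 1 ∈ flipSet M s ↔ L ((m + 1 : ℕ) : ℤ) = s := by
    rw [mem_flipSet]
    constructor
    · rintro ⟨m', ⟨_, hL⟩, hmm'⟩
      have : m' = m := by omega
      subst this
      exact hL
    · exact fun hL => ⟨m, ⟨hm, hL⟩, rfl⟩
  by_cases hL : L ((m + 1 : ℕ) : ℤ) = s
  · rw [if_pos (hiff.mpr hL), if_pos hL]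
  · rw [if_neg (fun h => hL (hiff.mp h)), if_neg hL]

/-- **The steering construction.** For every `M` there is a finite set `P` of primes, all
`> 2M + 1`, such that the pretender sum at `(c,n,n') = (1,1,2)` has modulus at least the number
of switchable terms: `#(switchSet M) ≤ |Σ_{m∈(M,2M]} twist P (m+1) · twist P (2m+1)|`.
(Take `P = flipSet M s` with `s = ±1` the sign of the non-switchable part `T`: every switchable
term becomes `s`, so the sum is `T + s·#switchSet`, of modulus `|T| + #switchSet`.) -/
theorem pretender_sum (M : ℕ) :
    ∃ P : Finset ℕ, (∀ p ∈ P, p.Prime ∧ 2 * M + 1 < p) ∧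
      ((switchSet M).card : ℝ) ≤
        |∑ m ∈ Ioc M (2 * M), twist P (m + 1) * twist P (2 * m + 1)| := by
  -- the non-switchable part `T` and its sign `s`
  have hs1 : ∀ T : ℝ, (if 0 ≤ T then (1 : ℝ) else -1) = 1 ∨ (if 0 ≤ T then (1 : ℝ) else -1) = -1 :=
    fun T => by split_ifs <;> simp
  let T : ℝ := ∑ m ∈ (Ioc M (2 * M)).filter (fun m => ¬ (2 * m + 1).Prime),
    L ((m + 1 : ℕ) : ℤ) * L ((2 * m + 1 : ℕ) : ℤ)
  let s : ℝ := if 0 ≤ T then 1 else -1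
  refine ⟨flipSet M s, fun p hp => prime_and_lt_of_mem_flipSet hp, ?_⟩
  -- every switchable term equals `s`
  have hsw : ∀ m ∈ switchSet M,
      twist (flipSet M s) (m + 1) * twist (flipSet M s) (2 * m + 1) = s := by
    intro m hm
    have hm2 : m ≤ 2 * M := (mem_switchSet.mp hm).1.2
    rw [twist_flipSet_first s hm2, twist_flipSet_second_of_mem s hm]
    have hpos : (0 : ℤ) < ((m + 1 : ℕ) : ℤ) := by positivity
    have hL : L ((m + 1 : ℕ) : ℤ) = 1 ∨ L ((m + 1 : ℕ) : ℤ) = -1 := by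
      rw [L_of_pos hpos]; exact neg_one_pow_eq_or ℝ _
    rcases hL with h1 | h1 <;> rcases hs1 T with h2 | h2 <;> push_cast at h1 <;> norm_num [h1, h2, s]
  -- every non-switchable term is the `λ`-term
  have hns : ∀ m ∈ (Ioc M (2 * M)).filter (fun m => ¬ (2 * m + 1).Prime),
      twist (flipSet M s) (m + 1) * twist (flipSet M s) (2 * m + 1) =
        L ((m + 1 : ℕ) : ℤ) * L ((2 * m + 1 : ℕ) : ℤ) := by
    intro m hm
    rw [mem_filter, mem_Ioc] at hm
    rw [twist_flipSet_first s hm.1.2, twist_flipSet_second_of_not_prime s hm.1.2 hm.2]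
  -- split the sum into switchable and non-switchable terms
  have hsplit : ∑ m ∈ Ioc M (2 * M), twist (flipSet M s) (m + 1) * twist (flipSet M s) (2 * m + 1)
      = s * (switchSet M).card + T := by
    rw [← sum_filter_add_sum_filter_not (Ioc M (2 * M)) (fun m => (2 * m + 1).Prime)]
    congr 1
    · rw [show (Ioc M (2 * M)).filter (fun m => (2 * m + 1).Prime) = switchSet M from rfl,
        sum_congr rfl hsw, sum_const, nsmul_eq_mul, mul_comm]
    · exact sum_congr rfl hns
  rw [hsplit]
  -- `|s·B + T| = B + |T| ≥ B`
  have hB : (0 : ℝ) ≤ (switchSet M).card := Nat.cast_nonneg _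
  by_cases hT0 : 0 ≤ T
  · have hs : s = 1 := if_pos hT0
    rw [hs, one_mul, abs_of_nonneg (by linarith)]
    linarith
  · have hs : s = -1 := if_neg hT0
    push Not at hT0
    rw [hs, neg_one_mul, abs_of_neg (by linarith)]
    linarith

/-- **Pretender failure (packaged).** For every `M` there is a completely multiplicative
`f : ℕ → {±1}` with `f(p) = −1 = λ(p)` for every prime `p ≤ 2M+1` whose pencil sum at
`(c,n,n') = (1,1,2)` is, in modulus, at least the number of primes in `(2M+1, 4M+1]`. -/
theorem pretender_failure (M : ℕ) :
    ∃ f : ℕ → ℝ, (∀ a b : ℕ, f (a * b) = f a * f b) ∧ (∀ k : ℕ, 1 ≤ k → f k = 1 ∨ f k = -1) ∧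
      (∀ p : ℕ, p.Prime → p ≤ 2 * M + 1 → f p = -1) ∧
      ((switchSet M).card : ℝ) ≤ |∑ m ∈ Ioc M (2 * M), f (m + 1) * f (2 * m + 1)| := by
  obtain ⟨P, hP, hsum⟩ := pretender_sum M
  refine ⟨twist P, twist_mul P, fun k hk => twist_eq_one_or P hk, fun p hp hple => ?_, hsum⟩
  rw [twist_prime P hp, if_neg]
  intro hpP
  have := (hP p hpP).2
  omega

/-! ## §3 Counting the switches: `π(4M+1) − π(2M+1) ≥ M / log(2M+1)` -/

/-- The switchable `m` correspond to the primes of `(2M+1, 4M+1]` (all odd) via `m ↦ 2m+1`. -/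
theorem image_switchSet (M : ℕ) :
    (switchSet M).image (fun m => 2 * m + 1) = (Ioc (2 * M + 1) (4 * M + 1)).filter Nat.Prime := by
  ext p
  simp only [switchSet, mem_image, mem_filter, mem_Ioc]
  constructor
  · rintro ⟨m, ⟨⟨h1, h2⟩, hp⟩, rfl⟩
    exact ⟨⟨by omega, by omega⟩, hp⟩
  · rintro ⟨⟨h1, h2⟩, hp⟩
    have hodd : ¬ 2 ∣ p := fun h2d => by
      have := (Nat.prime_dvd_prime_iff_eq Nat.prime_two hp).mp h2d
      omega
    refine ⟨(p - 1) / 2, ⟨⟨by omega, by omega⟩, ?_⟩, by omega⟩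
    rwa [show 2 * ((p - 1) / 2) + 1 = p by omega]

/-- `#switchSet M = #{p ∈ (2M+1, 4M+1] : p prime}`. -/
theorem card_switchSet_eq (M : ℕ) :
    (switchSet M).card = ((Ioc (2 * M + 1) (4 * M + 1)).filter Nat.Prime).card := by
  rw [← image_switchSet,
    card_image_of_injective _ (fun a b h => by have h' : 2 * a + 1 = 2 * b + 1 := h; omega)]

/-- Primes in `(a, b]` counted by `π`: `#{p ∈ (a,b] prime} = π(b) − π(a)` for `a ≤ b`. -/
theorem card_primes_Ioc (a b : ℕ) (hab : a ≤ b) :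
    ((Ioc a b).filter Nat.Prime).card = Nat.primeCounting b - Nat.primeCounting a := by
  have h1 : Nat.primeCounting b = ((range (b + 1)).filter Nat.Prime).card := by
    rw [Nat.primeCounting, Nat.primeCounting', Nat.count_eq_card_filter_range]
  have h2 : Nat.primeCounting a = ((range (a + 1)).filter Nat.Prime).card := by
    rw [Nat.primeCounting, Nat.primeCounting', Nat.count_eq_card_filter_range]
  have hsplit : range (b + 1) = range (a + 1) ∪ Ioc a b := by
    ext x; simp only [mem_union, mem_range, mem_Ioc]; omega
  have hdisj : Disjoint ((range (a + 1)).filter Nat.Prime) ((Ioc a b).filter Nat.Prime) := by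
    apply disjoint_filter_filter
    rw [disjoint_left]
    intro x hx hx'
    rw [mem_range] at hx
    rw [mem_Ioc] at hx'
    omega
  rw [h1, h2, hsplit, filter_union, card_union_of_disjoint hdisj]
  omega

/-- `#switchSet M = π(4M+1) − π(2M+1)`. -/
theorem card_switchSet_eq_primeCounting_sub (M : ℕ) :
    (switchSet M).card = Nat.primeCounting (4 * M + 1) - Nat.primeCounting (2 * M + 1) := by
  rw [card_switchSet_eq, card_primes_Ioc _ _ (by omega)]

end Summit.Parity.GeneralizedHardyLittlewood.Theorems.DilatedChowla.Negative

end
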